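import Literature.Probability.Percolation.KozmaNitzanSeparatingTriple
import HarnessLib

/-!
# Kozma–Nitzan (2024), Lemma 2: superadditivity of the attachment ratios `φ(X) = P(0 ↔ A(X) | A(X) ↮ A(Xᶜ))`
# over blocks — PROVED (two blocks; with the two Lemma-1 steps in denominator-free form)

Topic `Literature/Probability/Percolation`.  Source: G. Kozma, S. Nitzan, *A reduction of the `θ(p_c) = 0`
problem to a conjectured inequality*, arXiv:2401.12397 (2024) [KozmaNitzan2024], §2.2, Lemma 1 (pp. 5–6) and
Lemma 2 (p. 6).  Companion of `KozmaNitzanPreFKG.lean` / `KozmaNitzanSeparatingTriple.lean`, whose set-valued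
event forms of the van den Berg–Häggström–Kahn inequality (`KNSep.bhk_set_event_pos`, `KNSep.bhk_set_event_neg`)
are the engine.  Everything here is PROVED; no definition and no named fact is introduced.

## Printed statements

* **Lemma 1** (pp. 5–6): with `A = {a_j}`, `X ⊂ {1,…,n}`, `A(X) = {a_j}_{j∈X}`: "(i) If `Q` is an increasing event
  defined on the cluster of `A(X)` or a decreasing event defined on the cluster of `A(Xᶜ)` then
  `P(0 ↔ A(X) | A(X) ↮ A(Xᶜ)) ≤ P(0 ↔ A(X) | A(X) ↮ A(Xᶜ), Q)`.  (ii) If `Q` is a decreasing event defined on the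
  cluster of `A(X)` or an increasing event defined on the cluster of `A(Xᶜ)` then
  `P(0 ↔ A(X) | A(X) ↮ A(Xᶜ), Q) ≤ P(0 ↔ A(X) | A(X) ↮ A(Xᶜ))`."
* **Lemma 2** (p. 6): "denote `φ(X) := P(0 ↔ A(X) | A(X) ↮ A(Xᶜ))`.  For some `X`, assume a decomposition
  `X = ⋃_k X_k` with the sets `X_k` being disjoint.  Then `Σ_k φ(X_k) ≤ φ(X)`."  Printed proof: with
  `M := {A(X) ↮ A(Xᶜ), A(X_k) ↮ A(X_kᶜ) ∀k}`, Lemma 1(i) gives `φ(X_k) ≤ P(0 ↔ A(X_k) | M)`, the events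
  `{0 ↔ A(X_k)}` are disjoint under `M`, and Lemma 1(ii) gives `P(0 ↔ A(X) | M) ≤ φ(X)`.

## Transcription

Weights `w : Sym2 V → [0,1]` on a finite vertex type, `μ = prodBernoulli w`; three vertex sets `X, Y, Z` (the two
blocks and the rest `Z = A ∖ (X ∪ Y)`; disjointness is not needed for the inequalities as stated); the observer `o`
(printed `0`).  `{W ↮ W'} = {ω | ∀ s ∈ W, ∀ t ∈ W', ¬ s ↔ t}`, `{o ↔ W} = {ω | ∃ s ∈ W, s ↔ o}`,
`M = {X ↮ Y} ∩ {X ↮ Z} ∩ {Y ↮ Z}`.  Results: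

* `KNLemma2.conn_sep_mul_le` — the Lemma-1(i) step: `μ({o↔X} ∩ {X ↮ Y∪Z})·μ(M) ≤ μ({X ↮ Y∪Z})·μ({o↔X} ∩ M)`;
* `KNLemma2.sep_mul_conn_le` — the Lemma-1(ii) step: `μ({X∪Y ↮ Z})·μ({o↔X∪Y} ∩ M) ≤ μ({o↔X∪Y} ∩ {X∪Y ↮ Z})·μ(M)`;
* `KNLemma2.conn_union_inter_M` — `μ({o↔X∪Y} ∩ M) = μ({o↔X} ∩ M) + μ({o↔Y} ∩ M)`;
* `KozmaNitzan2024_lemma2` — **Lemma 2 for two blocks**: `φ(X) + φ(Y) ≤ φ(X ∪ Y)` whenever `μ(M) ≠ 0`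
  (the printed statement divides by `P(M)`; the general finite decomposition follows by induction on the number
  of blocks).  The singleton case summed over all relays is the tree's lonely-relay lemma
  (`Summit…Theorems.lonelyRelay`); the pair and triple cases are the `(P3)` inputs of the star-sink certificates
  `Summit…Theorems.StarSinkMixture.cert_one/cert_two/desigFour_ge`.
-/

noncomputable section

open MeasureTheory Set
open Literature.Probability.LatticeModels (prodBernoulli)

namespace Literature.Probability.Percolation

variable {V : Type*}

namespace KNLemma2

/-! ### Reading the events on the clusters -/

/-- `{o ↔ W}` read on the union of the open edge clusters of `W`. [cite: VandenbergHaggstromKahn2005, §1 p. 3] -/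
theorem conn_iff_cluster (ω : BondConfig V) (W : Set V) (o : V) :
    (∃ s ∈ W, (openGraph ω).Reachable s o) ↔
      ∃ s ∈ W, (openGraph (⋃ t ∈ W, openEdgeCluster ω t)).Reachable s o := by
  constructor
  · rintro ⟨s, hs, h⟩
    exact ⟨s, hs, (KNSep.reachable_iff_cluster ω W hs o).1 h⟩
  · rintro ⟨s, hs, h⟩
    exact ⟨s, hs, (KNSep.reachable_iff_cluster ω W hs o).2 h⟩

/-- `{W₁ ↮ W₂}` for `W₁, W₂ ⊆ W` read on the union of the open edge clusters of `W`.
[cite: VandenbergHaggstromKahn2005, §1 p. 3] -/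
theorem sep_iff_cluster (ω : BondConfig V) (W W₁ W₂ : Set V) (h₁ : W₁ ⊆ W) :
    (∀ s ∈ W₁, ∀ t ∈ W₂, ¬ (openGraph ω).Reachable s t) ↔
      ∀ s ∈ W₁, ∀ t ∈ W₂, ¬ (openGraph (⋃ u ∈ W, openEdgeCluster ω u)).Reachable s t := by
  constructor
  · intro h s hs t ht hst
    exact h s hs t ht ((KNSep.reachable_iff_cluster ω W (h₁ hs) t).2 hst)
  · intro h s hs t ht hst
    exact h s hs t ht ((KNSep.reachable_iff_cluster ω W (h₁ hs) t).1 hst)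

/-- `{X ↮ Y ∪ Z} = {X ↮ Y} ∩ {X ↮ Z}`. [folklore] -/
theorem sep_union_eq (X Y Z : Set V) :
    {ω : BondConfig V | ∀ s ∈ X, ∀ t ∈ Y ∪ Z, ¬ (openGraph ω).Reachable s t} =
      {ω | ∀ s ∈ X, ∀ t ∈ Y, ¬ (openGraph ω).Reachable s t} ∩
        {ω | ∀ s ∈ X, ∀ t ∈ Z, ¬ (openGraph ω).Reachable s t} := by
  ext ω
  simp only [Set.mem_setOf_eq, Set.mem_inter_iff, Set.mem_union]
  constructor
  · intro h
    exact ⟨fun s hs t ht => h s hs t (Or.inl ht), fun s hs t ht => h s hs t (Or.inr ht)⟩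
  · rintro ⟨h1, h2⟩ s hs t ht
    rcases ht with ht | ht
    · exact h1 s hs t ht
    · exact h2 s hs t ht

/-- `{X ∪ Y ↮ Z} = {X ↮ Z} ∩ {Y ↮ Z}`. [folklore] -/
theorem union_sep_eq (X Y Z : Set V) :
    {ω : BondConfig V | ∀ s ∈ X ∪ Y, ∀ t ∈ Z, ¬ (openGraph ω).Reachable s t} =
      {ω | ∀ s ∈ X, ∀ t ∈ Z, ¬ (openGraph ω).Reachable s t} ∩
        {ω | ∀ s ∈ Y, ∀ t ∈ Z, ¬ (openGraph ω).Reachable s t} := by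
  ext ω
  simp only [Set.mem_setOf_eq, Set.mem_inter_iff, Set.mem_union]
  constructor
  · intro h
    exact ⟨fun s hs t ht => h s (Or.inl hs) t ht, fun s hs t ht => h s (Or.inr hs) t ht⟩
  · rintro ⟨h1, h2⟩ s hs t ht
    rcases hs with hs | hs
    · exact h1 s hs t ht
    · exact h2 s hs t ht

/-- `{Y ↮ X} = {X ↮ Y}`. [folklore] -/
theorem sep_comm (X Y : Set V) :
    {ω : BondConfig V | ∀ s ∈ Y, ∀ t ∈ X, ¬ (openGraph ω).Reachable s t} =
      {ω | ∀ s ∈ X, ∀ t ∈ Y, ¬ (openGraph ω).Reachable s t} := by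
  ext ω
  simp only [Set.mem_setOf_eq]
  constructor
  · exact fun h s hs t ht hst => h t ht s hs hst.symm
  · exact fun h s hs t ht hst => h t ht s hs hst.symm

variable [Fintype V]

/-! ### The two Lemma-1 steps and the disjointness step -/

/-- **Kozma–Nitzan Lemma 1(i), the step used in Lemma 2** (denominator-free): with
`D_X = {X ↮ Y ∪ Z}` and `M = D_X ∩ {Y ↮ Z}` (`{Y ↮ Z}` is a decreasing event read on the cluster of `Y ∪ Z`),
`μ({o ↔ X} ∩ D_X) · μ(M) ≤ μ(D_X) · μ({o ↔ X} ∩ M)`, i.e. `φ(X) ≤ P(o ↔ X | M)`.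
[cite: KozmaNitzan2024, Lemma 1(i) (pp. 5–6) and proof of Lemma 2 (p. 6)] -/
theorem conn_sep_mul_le (w : Sym2 V → unitInterval) (X Y Z : Set V) (o : V) :
    (prodBernoulli w).real ({ω : BondConfig V | ∀ s ∈ X, ∀ t ∈ Y ∪ Z, ¬ (openGraph ω).Reachable s t} ∩
        {ω | ∃ s ∈ X, (openGraph ω).Reachable s o}) *
      (prodBernoulli w).real ({ω : BondConfig V | ∀ s ∈ X, ∀ t ∈ Y ∪ Z, ¬ (openGraph ω).Reachable s t} ∩
        {ω | ∀ s ∈ Y, ∀ t ∈ Z, ¬ (openGraph ω).Reachable s t}) ≤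
    (prodBernoulli w).real {ω : BondConfig V | ∀ s ∈ X, ∀ t ∈ Y ∪ Z, ¬ (openGraph ω).Reachable s t} *
      (prodBernoulli w).real ({ω : BondConfig V | ∀ s ∈ X, ∀ t ∈ Y ∪ Z, ¬ (openGraph ω).Reachable s t} ∩
        ({ω | ∃ s ∈ X, (openGraph ω).Reachable s o} ∩
         {ω | ∀ s ∈ Y, ∀ t ∈ Z, ¬ (openGraph ω).Reachable s t})) := by
  have key := KNSep.bhk_set_event_pos w X (Y ∪ Z)
    (fun C _ => ∃ s ∈ X, (openGraph C).Reachable s o)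
    (fun _ D => ∀ s ∈ Y, ∀ t ∈ Z, ¬ (openGraph D).Reachable s t)
    (fun D C C' hCC' h => by
      obtain ⟨s, hs, hso⟩ := h
      exact ⟨s, hs, hso.mono (openGraph_mono hCC')⟩)
    (fun C D D' hDD' h => h)
    (fun D C C' hCC' h => h)
    (fun C D D' hDD' h s hs t ht hst => h s hs t ht (hst.mono (openGraph_mono hDD')))
  have hP : {ω : BondConfig V | ∃ s ∈ X, (openGraph (⋃ t ∈ X, openEdgeCluster ω t)).Reachable s o} =
      {ω | ∃ s ∈ X, (openGraph ω).Reachable s o} := by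
    ext ω; exact (conn_iff_cluster ω X o).symm
  have hQ : {ω : BondConfig V | ∀ s ∈ Y, ∀ t ∈ Z,
        ¬ (openGraph (⋃ u ∈ Y ∪ Z, openEdgeCluster ω u)).Reachable s t} =
      {ω | ∀ s ∈ Y, ∀ t ∈ Z, ¬ (openGraph ω).Reachable s t} := by
    ext ω; exact (sep_iff_cluster ω (Y ∪ Z) Y Z Set.subset_union_left).symm
  simp only [hP, hQ] at key
  exact key

/-- **Kozma–Nitzan Lemma 1(ii), the step used in Lemma 2** (denominator-free): with
`D = {X ∪ Y ↮ Z}` and `M = D ∩ {X ↮ Y}` (`{X ↮ Y}` is a decreasing event read on the cluster of `X ∪ Y`),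
`μ(D) · μ({o ↔ X ∪ Y} ∩ M) ≤ μ({o ↔ X ∪ Y} ∩ D) · μ(M)`, i.e. `P(o ↔ X ∪ Y | M) ≤ φ(X ∪ Y)`.
[cite: KozmaNitzan2024, Lemma 1(ii) (pp. 5–6) and proof of Lemma 2 (p. 6)] -/
theorem sep_mul_conn_le (w : Sym2 V → unitInterval) (X Y Z : Set V) (o : V) :
    (prodBernoulli w).real {ω : BondConfig V | ∀ s ∈ X ∪ Y, ∀ t ∈ Z, ¬ (openGraph ω).Reachable s t} *
      (prodBernoulli w).real ({ω : BondConfig V | ∀ s ∈ X ∪ Y, ∀ t ∈ Z, ¬ (openGraph ω).Reachable s t} ∩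
        ({ω | ∃ s ∈ X ∪ Y, (openGraph ω).Reachable s o} ∩
         {ω | ∀ s ∈ X, ∀ t ∈ Y, ¬ (openGraph ω).Reachable s t})) ≤
    (prodBernoulli w).real ({ω : BondConfig V | ∀ s ∈ X ∪ Y, ∀ t ∈ Z, ¬ (openGraph ω).Reachable s t} ∩
        {ω | ∃ s ∈ X ∪ Y, (openGraph ω).Reachable s o}) *
      (prodBernoulli w).real ({ω : BondConfig V | ∀ s ∈ X ∪ Y, ∀ t ∈ Z, ¬ (openGraph ω).Reachable s t} ∩
        {ω | ∀ s ∈ X, ∀ t ∈ Y, ¬ (openGraph ω).Reachable s t}) := by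
  have key := KNSep.bhk_set_event_neg w (X ∪ Y) Z
    (fun C _ => ∃ s ∈ X ∪ Y, (openGraph C).Reachable s o)
    (fun C _ => ∀ s ∈ X, ∀ t ∈ Y, ¬ (openGraph C).Reachable s t)
    (fun D C C' hCC' h => by
      obtain ⟨s, hs, hso⟩ := h
      exact ⟨s, hs, hso.mono (openGraph_mono hCC')⟩)
    (fun C D D' hDD' h => h)
    (fun D C C' hCC' h s hs t ht hst => h s hs t ht (hst.mono (openGraph_mono hCC')))
    (fun C D D' hDD' h => h)
  have hP : {ω : BondConfig V | ∃ s ∈ X ∪ Y,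
        (openGraph (⋃ t ∈ X ∪ Y, openEdgeCluster ω t)).Reachable s o} =
      {ω | ∃ s ∈ X ∪ Y, (openGraph ω).Reachable s o} := by
    ext ω; exact (conn_iff_cluster ω (X ∪ Y) o).symm
  have hQ : {ω : BondConfig V | ∀ s ∈ X, ∀ t ∈ Y,
        ¬ (openGraph (⋃ u ∈ X ∪ Y, openEdgeCluster ω u)).Reachable s t} =
      {ω | ∀ s ∈ X, ∀ t ∈ Y, ¬ (openGraph ω).Reachable s t} := by
    ext ω; exact (sep_iff_cluster ω (X ∪ Y) X Y Set.subset_union_left).symm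
  simp only [hP, hQ] at key
  exact key

/-- **Disjointness under `M`.**  On `{X ↮ Y}` the events `{o ↔ X}` and `{o ↔ Y}` are disjoint and their union is
`{o ↔ X ∪ Y}`; hence for any event `E ⊆ {X ↮ Y}`,
`μ({o ↔ X∪Y} ∩ E) = μ({o ↔ X} ∩ E) + μ({o ↔ Y} ∩ E)`. [cite: KozmaNitzan2024, proof of Lemma 2 (p. 6)] -/
theorem conn_union_inter_eq (μ : Measure (BondConfig V)) [IsFiniteMeasure μ] (X Y : Set V) (o : V)
    (E : Set (BondConfig V)) (hE : E ⊆ {ω | ∀ s ∈ X, ∀ t ∈ Y, ¬ (openGraph ω).Reachable s t}) :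
    μ.real ({ω : BondConfig V | ∃ s ∈ X ∪ Y, (openGraph ω).Reachable s o} ∩ E) =
      μ.real ({ω | ∃ s ∈ X, (openGraph ω).Reachable s o} ∩ E) +
        μ.real ({ω | ∃ s ∈ Y, (openGraph ω).Reachable s o} ∩ E) := by
  have hU : {ω : BondConfig V | ∃ s ∈ X ∪ Y, (openGraph ω).Reachable s o} ∩ E =
      ({ω | ∃ s ∈ X, (openGraph ω).Reachable s o} ∩ E) ∪ ({ω | ∃ s ∈ Y, (openGraph ω).Reachable s o} ∩ E) := by
    ext ω
    simp only [Set.mem_inter_iff, Set.mem_setOf_eq, Set.mem_union]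
    constructor
    · rintro ⟨⟨s, hs, hso⟩, hωE⟩
      rcases hs with hs | hs
      · exact Or.inl ⟨⟨s, hs, hso⟩, hωE⟩
      · exact Or.inr ⟨⟨s, hs, hso⟩, hωE⟩
    · rintro (⟨⟨s, hs, hso⟩, hωE⟩ | ⟨⟨s, hs, hso⟩, hωE⟩)
      · exact ⟨⟨s, Or.inl hs, hso⟩, hωE⟩
      · exact ⟨⟨s, Or.inr hs, hso⟩, hωE⟩
  have hd : Disjoint ({ω : BondConfig V | ∃ s ∈ X, (openGraph ω).Reachable s o} ∩ E)
      ({ω | ∃ s ∈ Y, (openGraph ω).Reachable s o} ∩ E) := by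
    refine Set.disjoint_left.2 ?_
    rintro ω ⟨⟨s, hs, hso⟩, hωE⟩ ⟨⟨t, ht, hto⟩, _⟩
    exact hE hωE s hs t ht (hso.trans hto.symm)
  rw [hU, measureReal_union hd MeasurableSet.of_discrete]

/-! ### Lemma 2 -/

/-- **Kozma–Nitzan 2024, Lemma 2 (two blocks), PROVED.**  For vertex sets `X, Y, Z` (two blocks and the remaining
relays) and an observer `o`, with `φ(W | W') := μ({o ↔ W} ∩ {W ↮ W'}) / μ({W ↮ W'})` and
`M = {X ↮ Y∪Z} ∩ {Y ↮ Z}` (all three parts mutually separated): if `μ(M) ≠ 0` then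

  `φ(X | Y ∪ Z) + φ(Y | X ∪ Z) ≤ φ(X ∪ Y | Z)`.

Printed: "`Σ_k φ(X_k) ≤ φ(X)`" for a disjoint decomposition `X = ⋃ X_k`, `φ(X) = P(0 ↔ A(X) | A(X) ↮ A(Xᶜ))`; the
case of two blocks is stated here (the general case follows by induction on the number of blocks), with the
non-degeneracy `P(M) > 0` that the printed proof uses when it conditions on `M`.
[cite: KozmaNitzan2024, Lemma 2 (p. 6)] -/
theorem _root_.Literature.Probability.Percolation.KozmaNitzan2024_lemma2 (w : Sym2 V → unitInterval)
    (X Y Z : Set V) (o : V)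
    (hM : (prodBernoulli w).real ({ω : BondConfig V | ∀ s ∈ X, ∀ t ∈ Y ∪ Z, ¬ (openGraph ω).Reachable s t} ∩
        {ω | ∀ s ∈ Y, ∀ t ∈ Z, ¬ (openGraph ω).Reachable s t}) ≠ 0) :
    (prodBernoulli w).real ({ω : BondConfig V | ∃ s ∈ X, (openGraph ω).Reachable s o} ∩
          {ω | ∀ s ∈ X, ∀ t ∈ Y ∪ Z, ¬ (openGraph ω).Reachable s t}) /
        (prodBernoulli w).real {ω : BondConfig V | ∀ s ∈ X, ∀ t ∈ Y ∪ Z, ¬ (openGraph ω).Reachable s t} +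
      (prodBernoulli w).real ({ω : BondConfig V | ∃ s ∈ Y, (openGraph ω).Reachable s o} ∩
          {ω | ∀ s ∈ Y, ∀ t ∈ X ∪ Z, ¬ (openGraph ω).Reachable s t}) /
        (prodBernoulli w).real {ω : BondConfig V | ∀ s ∈ Y, ∀ t ∈ X ∪ Z, ¬ (openGraph ω).Reachable s t} ≤
    (prodBernoulli w).real ({ω : BondConfig V | ∃ s ∈ X ∪ Y, (openGraph ω).Reachable s o} ∩
          {ω | ∀ s ∈ X ∪ Y, ∀ t ∈ Z, ¬ (openGraph ω).Reachable s t}) /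
        (prodBernoulli w).real {ω : BondConfig V | ∀ s ∈ X ∪ Y, ∀ t ∈ Z, ¬ (openGraph ω).Reachable s t} := by
  set μ := prodBernoulli w with hμ
  -- the events
  set CX : Set (BondConfig V) := {ω | ∃ s ∈ X, (openGraph ω).Reachable s o} with hCX
  set CY : Set (BondConfig V) := {ω | ∃ s ∈ Y, (openGraph ω).Reachable s o} with hCY
  set CXY : Set (BondConfig V) := {ω | ∃ s ∈ X ∪ Y, (openGraph ω).Reachable s o} with hCXY
  set DX : Set (BondConfig V) := {ω | ∀ s ∈ X, ∀ t ∈ Y ∪ Z, ¬ (openGraph ω).Reachable s t} with hDX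
  set DY : Set (BondConfig V) := {ω | ∀ s ∈ Y, ∀ t ∈ X ∪ Z, ¬ (openGraph ω).Reachable s t} with hDY
  set DXY : Set (BondConfig V) := {ω | ∀ s ∈ X ∪ Y, ∀ t ∈ Z, ¬ (openGraph ω).Reachable s t} with hDXY
  set SXY : Set (BondConfig V) := {ω | ∀ s ∈ X, ∀ t ∈ Y, ¬ (openGraph ω).Reachable s t} with hSXY
  set SXZ : Set (BondConfig V) := {ω | ∀ s ∈ X, ∀ t ∈ Z, ¬ (openGraph ω).Reachable s t} with hSXZ
  set SYZ : Set (BondConfig V) := {ω | ∀ s ∈ Y, ∀ t ∈ Z, ¬ (openGraph ω).Reachable s t} with hSYZ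
  set M : Set (BondConfig V) := DX ∩ SYZ with hMdef
  -- the three descriptions of `M`
  have hDX' : DX = SXY ∩ SXZ := sep_union_eq X Y Z
  have hDY' : DY = SXY ∩ SYZ := by
    rw [hDY, sep_union_eq Y X Z, sep_comm X Y]
  have hDXY' : DXY = SXZ ∩ SYZ := union_sep_eq X Y Z
  have hM_Y : DY ∩ SXZ = M := by
    rw [hMdef, hDX', hDY']; ext ω; simp only [Set.mem_inter_iff]; tauto
  have hM_XY : DXY ∩ SXY = M := by
    rw [hMdef, hDX', hDXY']; ext ω; simp only [Set.mem_inter_iff]; tauto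
  have hMsub : M ⊆ SXY := by
    rw [hMdef, hDX']; intro ω hω; exact hω.1.1
  -- the four inequalities / identities
  have h1 : μ.real (DX ∩ CX) * μ.real M ≤ μ.real DX * μ.real (DX ∩ (CX ∩ SYZ)) :=
    conn_sep_mul_le w X Y Z o
  have h2 : μ.real (DY ∩ CY) * μ.real (DY ∩ SXZ) ≤ μ.real DY * μ.real (DY ∩ (CY ∩ SXZ)) :=
    conn_sep_mul_le w Y X Z o
  have h3 : μ.real DXY * μ.real (DXY ∩ (CXY ∩ SXY)) ≤ μ.real (DXY ∩ CXY) * μ.real (DXY ∩ SXY) :=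
    sep_mul_conn_le w X Y Z o
  have h4 : μ.real (CXY ∩ M) = μ.real (CX ∩ M) + μ.real (CY ∩ M) :=
    conn_union_inter_eq μ X Y o M hMsub
  -- normalise the intersections to `· ∩ M`
  have e1 : DX ∩ (CX ∩ SYZ) = CX ∩ M := by
    rw [hMdef]; ext ω; simp only [Set.mem_inter_iff]; tauto
  have e2 : DY ∩ (CY ∩ SXZ) = CY ∩ M := by
    rw [← hM_Y]; ext ω; simp only [Set.mem_inter_iff]; tauto
  have e3 : DXY ∩ (CXY ∩ SXY) = CXY ∩ M := by
    rw [← hM_XY]; ext ω; simp only [Set.mem_inter_iff]; tauto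
  rw [e1] at h1
  rw [hM_Y, e2] at h2
  rw [hM_XY, e3] at h3
  -- positivity facts
  have hMpos : 0 < μ.real M := lt_of_le_of_ne measureReal_nonneg (Ne.symm hM)
  have hMle : μ.real M ≤ μ.real DXY := by
    rw [← hM_XY]; exact measureReal_mono Set.inter_subset_left
  have hDXYpos : 0 < μ.real DXY := lt_of_lt_of_le hMpos hMle
  -- `φ(X) ≤ μ(CX ∩ M)/μ(M)` and the same for `Y`
  have hφX : μ.real (CX ∩ DX) / μ.real DX ≤ μ.real (CX ∩ M) / μ.real M := by
    by_cases hDX0 : μ.real DX = 0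
    · rw [hDX0, div_zero]; positivity
    · have hDXpos : 0 < μ.real DX := lt_of_le_of_ne measureReal_nonneg (Ne.symm hDX0)
      rw [div_le_div_iff₀ hDXpos hMpos, Set.inter_comm CX DX]
      linarith
  have hφY : μ.real (CY ∩ DY) / μ.real DY ≤ μ.real (CY ∩ M) / μ.real M := by
    by_cases hDY0 : μ.real DY = 0
    · rw [hDY0, div_zero]; positivity
    · have hDYpos : 0 < μ.real DY := lt_of_le_of_ne measureReal_nonneg (Ne.symm hDY0)
      rw [div_le_div_iff₀ hDYpos hMpos, Set.inter_comm CY DY]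
      linarith
  -- `μ(CXY ∩ M)/μ(M) ≤ φ(X ∪ Y)`
  have hφXY : μ.real (CXY ∩ M) / μ.real M ≤ μ.real (CXY ∩ DXY) / μ.real DXY := by
    rw [div_le_div_iff₀ hMpos hDXYpos, Set.inter_comm CXY DXY]
    linarith
  calc μ.real (CX ∩ DX) / μ.real DX + μ.real (CY ∩ DY) / μ.real DY
      ≤ μ.real (CX ∩ M) / μ.real M + μ.real (CY ∩ M) / μ.real M := add_le_add hφX hφY
    _ = μ.real (CXY ∩ M) / μ.real M := by rw [h4, add_div]
    _ ≤ μ.real (CXY ∩ DXY) / μ.real DXY := hφXY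

end KNLemma2

end Literature.Probability.Percolation

end
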